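import Summits.SmoothPoincare4.SmoothPoincare4.Theorems.NormalFormStablyTrivial.Negative.ZKernelsNormalForm
import Summits.SmoothPoincare4.SmoothPoincare4.Theorems.AgkCor6Sufficiency.Negative.StablyTrivialTight
import Summits.SmoothPoincare4.SmoothPoincare4.Theorems.WaldhausenPairs.Negative.LoadBearing

/-!
# `NormalFormStablyTrivial` — negative-side support IIa: pair ranks obstruct stable triviality;
# the Dehn twists `T_{b_h}`

Refuter support file (cdisprove seat) for crux item stmt-SmoothPoincare4-14591
(`CongruenceShadows.NormalFormStablyTrivial`).  Toolkit for `GateNeedsBothSides.lean`: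

* `isFreeOfRank_pairQuotient_stabilize(Iter)` — the `(i,j)` pair quotient of a stabilisation is the
  free product of the old one with `F_1` (the pair clause of `stabilize_isGroupTrisection_holds`,
  for an ARBITRARY triple), so ranks go up by one per stabilisation;
  `not_isStablyTrivial_of_pairRank` — **pair ranks obstruct stable triviality**: a genus-`3+3m`
  triple with a pair quotient free of rank `r ≠ m+1` is not stably trivial (ranks of f.g. free
  groups are well defined, `IsFreeOfRank.rank_eq`; the genus bookkeeping forces `m' = m + n`).  So
  the pair conditions of the normal form carry exactly the balancedness `k₁ = k₂ = k₃ = m+1`.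
* `twB h` — the Dehn twist `T_{b_h} : a_h ↦ a_h b_h` as a relator-fixing automorphism of `S_3`
  (`[ab, b] = [a, b]`; identities by `decide`), its generator values, and its action on the
  standard kernels: `T_{b₂} ∈ Stab N₀`, `T_{b₁} ∈ Stab N₁`, `T_{b₀} ∈ Stab N₂` (the twisting curve
  bounds in the corresponding handlebody), `T_{b₂}N₂ = ⟪b₀,a₁,a₂b₂⟫`, `T_{b₁}N₂ = ⟪b₀,a₁b₁,a₂⟫`,
  `T_{b₀}N₁ = ⟪a₀b₀,b₁,a₂⟫`.

Everything is proved; the only definitions are the explicit twists.  Nothing here concludes a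
Theses statement.

References: A. Abrams, D. Gay, R. Kirby, *Group trisections and smooth 4-manifolds*, Geom. Topol.
22 (2018), Def. 2–3 (stabilisation = slot-wise free product with the genus-3 `S⁴` triple);
D. Gay, R. Kirby, *Trisecting 4-manifolds*, Geom. Topol. 20 (2016), §2.
-/

-- the prescribed namespace `Summit.<P>.<Sub>.…` duplicates `SmoothPoincare4` (P = Sub)
set_option linter.dupNamespace false

noncomputable section

namespace Summit.SmoothPoincare4.SmoothPoincare4.Theorems.NormalFormStablyTrivial.Negative

open Literature.Topology.FourManifolds Subgroup RelatorAut
open Summit.SmoothPoincare4.SmoothPoincare4.Theorems.AgkCor6Sufficiency.Negative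
  (za zb isGroupTrisection_cast Iso.nonempty_pairQuotient_equiv)
open Summit.SmoothPoincare4.SmoothPoincare4.Theorems.WaldhausenPairs.Negative
  (stabilizeIter_isGroupTrisection IsFreeOfRank.rank_eq)

/-! ## §1 Pair ranks are stable invariants -/

/-- The `(i,j)` pair quotient of a stabilisation is the free product of the old one with `F_1`:
rank goes up by one (the pair clause of `stabilize_isGroupTrisection_holds`, for an arbitrary
triple). [cite: AbramsGayKirby2018, Def. 2–3] -/
theorem isFreeOfRank_pairQuotient_stabilize {g : ℕ} (K : TrisectionKernels g) {i j : Fin 3}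
    (hij : i ≠ j) {r : ℕ} (h : IsFreeOfRank (K.pairQuotient i j) r) :
    IsFreeOfRank (K.stabilize.pairQuotient i j) (r + 1) := by
  have e := stabQuotientEquivCoprod ((K i : Set (SurfaceGroup g)) ∪ K j)
    ((s4Kernels i : Set (SurfaceGroup 3)) ∪ s4Kernels j) (Or.inl (one_mem _)) (Or.inl (one_mem _))
  have h2 := h.coprod (s4Kernels_isGroupTrisection_holds.free_pairQuotient i j hij)
  refine (h2.of_mulEquiv e.symm).of_mulEquiv (QuotientGroup.quotientMulEquivOfEq ?_)
  rw [TrisectionKernels.stabilize_apply, TrisectionKernels.stabilize_apply,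
    normalClosure_union_normalClosure, stabSet_union]

/-- Iterated: the `(i,j)` pair quotient of `K.stabilizeIter n` is free of rank `r + n`. [folklore] -/
theorem isFreeOfRank_pairQuotient_stabilizeIter {g : ℕ} (K : TrisectionKernels g) {i j : Fin 3}
    (hij : i ≠ j) {r : ℕ} (h : IsFreeOfRank (K.pairQuotient i j) r) :
    ∀ n : ℕ, IsFreeOfRank ((K.stabilizeIter n).pairQuotient i j) (r + n)
  | 0 => h
  | n + 1 => isFreeOfRank_pairQuotient_stabilize _ hij (isFreeOfRank_pairQuotient_stabilizeIter K hij h n)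

/-- **PAIR RANKS OBSTRUCT STABLE TRIVIALITY.**  A genus-`3+3m` triple with an `(i,j)` pair
quotient free of rank `r ≠ m + 1` is not stably trivial (the standard triple of genus `3+3m'`
has all pair ranks `m'+1`, ranks add under stabilisation, and the genus bookkeeping forces
`m' = m + n`). [folklore] -/
theorem not_isStablyTrivial_of_pairRank {m : ℕ} {K : TrisectionKernels (3 + 3 * m)} {i j : Fin 3}
    (hij : i ≠ j) {r : ℕ} (h : IsFreeOfRank (K.pairQuotient i j) r) (hr : r ≠ m + 1) :
    ¬ K.IsStablyTrivial := by
  rintro ⟨n, m', hg, hiso⟩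
  have h1 := isFreeOfRank_pairQuotient_stabilizeIter K hij h n
  have h2 := (isGroupTrisection_cast (stabilizeIter_isGroupTrisection m') hg).free_pairQuotient i j hij
  obtain ⟨e⟩ := Iso.nonempty_pairQuotient_equiv hiso i j
  have h3 := IsFreeOfRank.rank_eq (h1.of_mulEquiv e) h2
  omega

/-! ## §2 The Dehn twists `T_{b_h} : a_h ↦ a_h b_h` -/

/-- Generator images of `T_{b_h}`: `a_h ↦ a_h b_h`, everything else fixed. [folklore] -/
def twBGen (h : Fin 3) (x : surfaceGen 3) : FreeGroup (surfaceGen 3) :=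
  if x = (h, false) then FreeGroup.of (h, false) * FreeGroup.of (h, true) else FreeGroup.of x

/-- Generator images of `T_{b_h}⁻¹`: `a_h ↦ a_h b_h⁻¹`. [folklore] -/
def twBInvGen (h : Fin 3) (x : surfaceGen 3) : FreeGroup (surfaceGen 3) :=
  if x = (h, false) then FreeGroup.of (h, false) * (FreeGroup.of (h, true))⁻¹ else FreeGroup.of x

/-- `T_{b_h}` as a relator-fixing automorphism of `S_3` (`[a b, b] = [a, b]` letter for letter
after free reduction; identities by `decide`). [folklore] -/
def twB (h : Fin 3) : RelatorAut 3 :=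
  ofGens (twBGen h) (twBInvGen h) (by fin_cases h <;> decide) (by fin_cases h <;> decide)
    (by fin_cases h <;> decide) (by fin_cases h <;> decide)

/-- `T_{b_h}` fixes every generator other than `a_h`. [folklore] -/
theorem twB_of {h : Fin 3} {x : surfaceGen 3} (hx : x ≠ (h, false)) :
    (twB h).toMulEquiv (PresentedGroup.of x) = PresentedGroup.of x := by
  rw [twB, ofGens_of]; simp [twBGen, hx, PresentedGroup.of]

/-- `T_{b_h} a_h = a_h b_h`. [folklore] -/
theorem twB_a (h : Fin 3) : (twB h).toMulEquiv (za h) = za h * zb h := by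
  rw [twB, ofGens_of]; simp [twBGen, PresentedGroup.of]

/-- `T_{b_h}⁻¹` fixes every generator other than `a_h`. [folklore] -/
theorem twB_symm_of {h : Fin 3} {x : surfaceGen 3} (hx : x ≠ (h, false)) :
    (twB h).toMulEquiv.symm (PresentedGroup.of x) = PresentedGroup.of x := by
  rw [twB, ofGens_symm_of]; simp [twBInvGen, hx, PresentedGroup.of]

/-- `T_{b_h}⁻¹ a_h = a_h b_h⁻¹`. [folklore] -/
theorem twB_symm_a (h : Fin 3) : (twB h).toMulEquiv.symm (za h) = za h * (zb h)⁻¹ := by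
  rw [twB, ofGens_symm_of]; simp [twBInvGen, PresentedGroup.of]

/-- A twist that fixes each listed generator fixes their normal closure. [folklore] -/
theorem map_twB_normalClosure_of_forall {h : Fin 3} (s : Set (surfaceGen 3))
    (hs : ∀ x ∈ s, x ≠ (h, false)) :
    (normalClosure (PresentedGroup.of '' s)).map (twB h).toMulEquiv.toMonoidHom =
      normalClosure (PresentedGroup.of '' s) := by
  refine map_normalClosure_eq_of _ _ _ ?_ ?_
  · rintro _ ⟨x, hx, rfl⟩
    rw [twB_of (hs x hx)]; exact subset_normalClosure ⟨x, hx, rfl⟩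
  · rintro _ ⟨x, hx, rfl⟩
    rw [twB_symm_of (hs x hx)]; exact subset_normalClosure ⟨x, hx, rfl⟩

/-- `T_{b₂} ∈ Stab N₀` (`N₀ = ⟪a₀,a₁,b₂⟫`: `b₂` bounds in `H₀`). [folklore] -/
theorem map_twB2_s4Kernels_zero : (s4Kernels 0).map (twB 2).toMulEquiv.toMonoidHom = s4Kernels 0 := by
  rw [s4Kernels_eq]
  exact map_twB_normalClosure_of_forall _ (by decide)

/-- `T_{b₁} ∈ Stab N₁` (`N₁ = ⟪a₀,b₁,a₂⟫`). [folklore] -/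
theorem map_twB1_s4Kernels_one : (s4Kernels 1).map (twB 1).toMulEquiv.toMonoidHom = s4Kernels 1 := by
  rw [s4Kernels_eq]
  exact map_twB_normalClosure_of_forall _ (by decide)

/-- `T_{b₀} ∈ Stab N₂` (`N₂ = ⟪b₀,a₁,a₂⟫`). [folklore] -/
theorem map_twB0_s4Kernels_two : (s4Kernels 2).map (twB 0).toMulEquiv.toMonoidHom = s4Kernels 2 := by
  rw [s4Kernels_eq]
  exact map_twB_normalClosure_of_forall _ (by decide)

/-- `N₂ = ⟪b₀,a₁,a₂⟫` in `za/zb` letters. [folklore] -/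
theorem s4Kernels_two_z : s4Kernels 2 = normalClosure {zb 0, za 1, za 2} := rfl

/-- `T_{b₂} N₂ = ⟪b₀, a₁, a₂b₂⟫`. [folklore] -/
theorem map_twB2_s4Kernels_two :
    (s4Kernels 2).map (twB 2).toMulEquiv.toMonoidHom = normalClosure {zb 0, za 1, za 2 * zb 2} := by
  rw [s4Kernels_two_z]
  refine map_normalClosure_eq_of _ _ _ ?_ ?_
  · intro x hx
    simp only [Set.mem_insert_iff, Set.mem_singleton_iff] at hx
    rcases hx with rfl | rfl | rfl
    · rw [show zb 0 = PresentedGroup.of ((0 : Fin 3), true) from rfl, twB_of (by decide)]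
      exact subset_normalClosure (by simp)
    · rw [show za 1 = PresentedGroup.of ((1 : Fin 3), false) from rfl, twB_of (by decide)]
      exact subset_normalClosure (by simp)
    · rw [twB_a]; exact subset_normalClosure (by simp)
  · intro y hy
    simp only [Set.mem_insert_iff, Set.mem_singleton_iff] at hy
    rcases hy with rfl | rfl | rfl
    · rw [show zb 0 = PresentedGroup.of ((0 : Fin 3), true) from rfl, twB_symm_of (by decide)]
      exact subset_normalClosure (by simp)
    · rw [show za 1 = PresentedGroup.of ((1 : Fin 3), false) from rfl, twB_symm_of (by decide)]
      exact subset_normalClosure (by simp)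
    · rw [map_mul, twB_symm_a, show zb 2 = PresentedGroup.of ((2 : Fin 3), true) from rfl,
        twB_symm_of (by decide)]
      have : za 2 * (PresentedGroup.of ((2 : Fin 3), true))⁻¹ * PresentedGroup.of ((2 : Fin 3), true) = za 2 := by
        simp
      rw [this]; exact subset_normalClosure (by simp)

/-- `T_{b₁} N₂ = ⟪b₀, a₁b₁, a₂⟫`. [folklore] -/
theorem map_twB1_s4Kernels_two :
    (s4Kernels 2).map (twB 1).toMulEquiv.toMonoidHom = normalClosure {zb 0, za 1 * zb 1, za 2} := by
  rw [s4Kernels_two_z]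
  refine map_normalClosure_eq_of _ _ _ ?_ ?_
  · intro x hx
    simp only [Set.mem_insert_iff, Set.mem_singleton_iff] at hx
    rcases hx with rfl | rfl | rfl
    · rw [show zb 0 = PresentedGroup.of ((0 : Fin 3), true) from rfl, twB_of (by decide)]
      exact subset_normalClosure (by simp)
    · rw [twB_a]; exact subset_normalClosure (by simp)
    · rw [show za 2 = PresentedGroup.of ((2 : Fin 3), false) from rfl, twB_of (by decide)]
      exact subset_normalClosure (by simp)
  · intro y hy
    simp only [Set.mem_insert_iff, Set.mem_singleton_iff] at hy
    rcases hy with rfl | rfl | rfl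
    · rw [show zb 0 = PresentedGroup.of ((0 : Fin 3), true) from rfl, twB_symm_of (by decide)]
      exact subset_normalClosure (by simp)
    · rw [map_mul, twB_symm_a, show zb 1 = PresentedGroup.of ((1 : Fin 3), true) from rfl,
        twB_symm_of (by decide)]
      have : za 1 * (PresentedGroup.of ((1 : Fin 3), true))⁻¹ * PresentedGroup.of ((1 : Fin 3), true) = za 1 := by
        simp
      rw [this]; exact subset_normalClosure (by simp)
    · rw [show za 2 = PresentedGroup.of ((2 : Fin 3), false) from rfl, twB_symm_of (by decide)]
      exact subset_normalClosure (by simp)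

/-- `N₁ = ⟪a₀,b₁,a₂⟫` in `za/zb` letters. [folklore] -/
theorem s4Kernels_one_z' : s4Kernels 1 = normalClosure {za 0, zb 1, za 2} := rfl

/-- `T_{b₀} N₁ = ⟪a₀b₀, b₁, a₂⟫`. [folklore] -/
theorem map_twB0_s4Kernels_one :
    (s4Kernels 1).map (twB 0).toMulEquiv.toMonoidHom = normalClosure {za 0 * zb 0, zb 1, za 2} := by
  rw [s4Kernels_one_z']
  refine map_normalClosure_eq_of _ _ _ ?_ ?_
  · intro x hx
    simp only [Set.mem_insert_iff, Set.mem_singleton_iff] at hx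
    rcases hx with rfl | rfl | rfl
    · rw [twB_a]; exact subset_normalClosure (by simp)
    · rw [show zb 1 = PresentedGroup.of ((1 : Fin 3), true) from rfl, twB_of (by decide)]
      exact subset_normalClosure (by simp)
    · rw [show za 2 = PresentedGroup.of ((2 : Fin 3), false) from rfl, twB_of (by decide)]
      exact subset_normalClosure (by simp)
  · intro y hy
    simp only [Set.mem_insert_iff, Set.mem_singleton_iff] at hy
    rcases hy with rfl | rfl | rfl
    · rw [map_mul, twB_symm_a, show zb 0 = PresentedGroup.of ((0 : Fin 3), true) from rfl,
        twB_symm_of (by decide)]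
      have : za 0 * (PresentedGroup.of ((0 : Fin 3), true))⁻¹ * PresentedGroup.of ((0 : Fin 3), true) = za 0 := by
        simp
      rw [this]; exact subset_normalClosure (by simp)
    · rw [show zb 1 = PresentedGroup.of ((1 : Fin 3), true) from rfl, twB_symm_of (by decide)]
      exact subset_normalClosure (by simp)
    · rw [show za 2 = PresentedGroup.of ((2 : Fin 3), false) from rfl, twB_symm_of (by decide)]
      exact subset_normalClosure (by simp)

end Summit.SmoothPoincare4.SmoothPoincare4.Theorems.NormalFormStablyTrivial.Negative

end
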